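import Summits.QuantumFields.BalabanUV.Beta.GAN24.MonotoneCritical

/-!
# Beta / GAN24 / MonotoneShorted — THE SHORTED (EFFECTIVE) FORM OF A DEGENERATE QUADRATIC FORM ALONG A SURJECTIVE AVERAGING, and the
# TWO-STAGE VARIATIONAL IDENTITY: «constrain the fine field through its averages» = «constrain the averages, with the effective form»
# (gan24-p4 gen 4; BINDER-OWNERS row G-an2-4 ∕ (CONV-C), ALTERNATIVE DISCHARGE «rate OR monotonicity»; NOT IN PRINT — our proof attempt)

HONEST FRAMING (page 1 of everything the β sub-cell writes): discharging `BetaPertH` makes Bałaban's UV stability UNCONDITIONAL — a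
real constructive-QFT result; it is NOT the continuum limit and NOT the Clay problem.  HONEST DEPENDENCY (cell reorg 2026-08-19, verbatim):
«continuum YM on T⁴ ⇐ BetaPertH ∧ nine spine estimates (0/9 proved); BetaPertH ⇐ (D1) ∧ (D4) ∧ CAP+tail; G-an2-4 gates asym, D1 and NE2/3/4.»
HONEST LABEL: «not in print; our proof attempt; alternative discharge of the G-an2-4 row (rate OR monotonicity)»; 0 wall binders instantiated.
ABSOLUTE RULE honoured: nothing is cited; [folklore] finite-dimensional linear algebra over gen 2's variational principle
(`MonotoneCoarsen.IsCrit`) and gen 3's canonical constrained covariance (`MonotoneCritical.critCov`); no `def … : Prop` is asserted of anything.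

## WHY (road P4, `HOME/b2b-balaban-gan24-p4/gen3/TORUS-AVATAR.md` § Reading, caveat (i))
Gen 3's headline `MonotoneTorusPlaquette.plaqCov_antitone_step` is a statement about the covariance of the level-`k` FINE field constrained
through its averages `Q_{Lc^{k+1}} A = 0` and read through `Q_{Lc^k}`.  To READ it as a statement about the `k`-th renormalization step one
needs the two-stage principle for DEGENERATE forms: minimising over the fine field `A` with prescribed average `B = C A` produces an EFFECTIVE
(«shorted») quadratic form `E` in `B`, and every covariance pairing of sources that factor through `C` can be computed from `E` and the
coarse constraints alone.  Gen 1∕2 typed this for positive DEFINITE forms (`MonotoneBlocks.effForm`, `MonotoneCoarsen.effForm_coarsen_ge`, p3's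
`decimate_flucCov_comp`); here it is done with NO definiteness and NO gauge fixing.  Consumer: `GAN24/MonotoneTorusEffective` (there `E` is
identified with Bałaban's printed `k`-step block action (1.65), tree def `Beta.BlockEffectiveAction.DelK`).

## THE OBJECTS.  `H` a (possibly degenerate) PSD form on the fine space `ι → 𝕜`; `C : Matrix κ ι 𝕜` the averaging onto the coarse space, with a
SECTION `S` (`C * S = 1`, i.e. `C` is surjective); `R` constraint rows on the coarse space; `critCov` = gen 3's canonical constrained covariance.
* `harmExt H C S := (1 − critCov H C · H) · S` — a «harmonic extension»: `harmExt B` minimises `⟨A, H A⟩` over the fibre `{A : C A = B}`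
  (`C_mul_harmExt`, `quad_harmExt_le`); it depends on the section `S` only through a zero mode of `H` in `ker C`.
* `shortForm H C S := harmExtᴴ · H · harmExt` — THE SHORTED FORM: `⟨B, shortForm B⟩ = min {⟨A, H A⟩ : C A = B}` (`shortForm_quad`,
  `shortForm_quad_le`, `shortForm_quad_eq_of_isMin`); PSD, Hermitian, independent of the section (`shortForm_eq_of_sections`).

## WHAT IS PROVED ([folklore] throughout)
* §1 `mul_critCov_eq_zero` (`C · critCov H C = 0`), `C_mul_harmExt` (`C · harmExt = 1`), `harmExt_orth` (`H·harmExt B ⊥ ker C` — the inner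
  Euler–Lagrange condition), `quad_harmExt_le` (Pythagoras on the fibre), `shortForm_quad(_le)`, `shortForm_posSemidef`, `shortForm_isHermitian`,
  `shortForm_quad_eq_of_isMin` (ANY minimiser on the fibre computes the shorted form — this is how Bałaban's `H_k` enters downstream).
* §2 **`H_mul_harmExt : H · harmExt = Cᴴ · shortForm`** (outer Euler–Lagrange; for Bałaban's objects this is `curlPart_Hk_mul`: `(½∂ᴴ∂)H_k = Q*Δ_k`),
  `harmExt_ker_of_shortForm_ker` ∕ `shortForm_mulVec_eq_zero_of_lift` (the null space of `shortForm` is EXACTLY `C (ker H)`), `shortForm_eq_of_sections`.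
* §3 THE TWO-STAGE IDENTITY: `legit_lift` (a coarse source invisible to `ker R ∩ ker shortForm` lifts to a fine source `Cᴴ r` invisible to
  `ker (R C) ∩ ker H`), `cross_pairing_eq_of_isCrit`, **`isCrit_harmExt`** (the harmonic extension of a coarse critical point is a fine critical
  point), **`pairing_twoStage : ⟨Cᴴ r, critCov H (R C) Cᴴ r'⟩ = ⟨r, critCov (shortForm) R r'⟩`**, and the matrix form
  **`readOut_twoStage : (T C)·critCov H (R C)·(T C)ᴴ = T·critCov (shortForm) R·Tᴴ`** for every test matrix `T` killing `ker R ∩ ker shortForm`.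
* §4 THE DEGENERATE (OSD): **`shortForm_coarsen_le`** — (STAB) `Cfᴴ H_c Cf ≤ H_f` for one refinement step `Cf` and (1.17) `C_f = C_c · Cf`
  ⟹ `shortForm H_c C_c ≤ shortForm H_f C_f` in the Loewner order (effective forms INCREASE under refinement; gen 1's (OSD) without definiteness).
NOT (CONV-C), NOT BetaPertH, NOT continuum, NOT Clay.
-/

noncomputable section

namespace Summit.QuantumFields.BalabanUV.Beta.GAN24.MonotoneShorted

open Matrix
open scoped ComplexOrder
open Summit.QuantumFields.BalabanUV.Beta.GAN24.MonotoneCoarsen (IsCrit conj_pairing)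
open Summit.QuantumFields.BalabanUV.Beta.GAN24.MonotoneCritical (critCov critCov_isHermitian isCrit_critCov mulVec_critCov_mem_ker)

variable {𝕜 : Type*} [RCLike 𝕜]
variable {ι κ : Type*} [Fintype ι] [DecidableEq ι] [Fintype κ] [DecidableEq κ]

section Helpers

omit [DecidableEq ι] in
/-- `⟨z, H x⟩ = 0` for a null vector `z` of a Hermitian `H`. [folklore] -/
theorem ker_pairing {H : Matrix ι ι 𝕜} (hH : H.IsHermitian) {z : ι → 𝕜} (hz : H *ᵥ z = 0) (x : ι → 𝕜) :
    star z ⬝ᵥ (H *ᵥ x) = 0 := by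
  rw [← conjTranspose_conjTranspose H, ← conj_pairing, hH.eq, hz, star_zero, zero_dotProduct]

omit [DecidableEq ι] [Fintype κ] [DecidableEq κ] in
/-- Membership in `ker C.mulVecLin` is `C v = 0`. [folklore] -/
theorem mem_ker_iff (C : Matrix κ ι 𝕜) (v : ι → 𝕜) : v ∈ LinearMap.ker C.mulVecLin ↔ C *ᵥ v = 0 := by
  simp [LinearMap.mem_ker]

omit [DecidableEq ι] in
/-- Two HERMITIAN matrices with the same quadratic form are equal (Loewner antisymmetry). [folklore] -/
theorem hermitian_ext_of_quad {X Y : Matrix ι ι 𝕜} (hX : X.IsHermitian) (hY : Y.IsHermitian)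
    (h : ∀ v : ι → 𝕜, star v ⬝ᵥ (X *ᵥ v) = star v ⬝ᵥ (Y *ᵥ v)) : X = Y := by
  open scoped MatrixOrder in
  refine le_antisymm ?_ ?_
  · rw [Matrix.le_iff]
    refine PosSemidef.of_dotProduct_mulVec_nonneg (hY.sub hX) fun v => ?_
    rw [sub_mulVec, dotProduct_sub, h v, sub_self]
  · rw [Matrix.le_iff]
    refine PosSemidef.of_dotProduct_mulVec_nonneg (hX.sub hY) fun v => ?_
    rw [sub_mulVec, dotProduct_sub, h v, sub_self]

omit [DecidableEq ι] in
/-- A vector orthogonal to everything vanishes. [folklore] -/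
theorem eq_zero_of_forall_pairing {d : ι → 𝕜} (h : ∀ x : ι → 𝕜, star x ⬝ᵥ d = 0) : d = 0 :=
  dotProduct_star_self_eq_zero.mp (h d)

end Helpers

/-! ## §1 The harmonic extension and the shorted form -/

section Shorted

variable {H : Matrix ι ι 𝕜}

/-- **HARMONIC EXTENSION** along the averaging `C` with section `S`: `harmExt H C S := (1 − critCov H C · H) · S`.  For every coarse `B`,
`harmExt B = S B − critCov H C (H S B)` lies in the fibre `C A = B` (when `C S = 1`) and minimises `⟨A, H A⟩` there. [folklore] -/
def harmExt (hH : H.IsHermitian) (C : Matrix κ ι 𝕜) (S : Matrix ι κ 𝕜) : Matrix ι κ 𝕜 :=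
  (1 - critCov hH C * H) * S

/-- **THE SHORTED (EFFECTIVE) FORM** of `H` along `C`: `shortForm H C S := harmExtᴴ · H · harmExt`, whose quadratic form at `B` is the minimum
of `⟨A, H A⟩` over the fibre `{A : C A = B}` (`shortForm_quad_le`, `shortForm_quad_eq_of_isMin`). [folklore] -/
def shortForm (hH : H.IsHermitian) (C : Matrix κ ι 𝕜) (S : Matrix ι κ 𝕜) : Matrix κ κ 𝕜 :=
  (harmExt hH C S)ᴴ * H * harmExt hH C S

/-- `C · critCov H C = 0` (every column of the canonical covariance satisfies the constraints). [folklore] -/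
theorem mul_critCov_eq_zero (hH : H.IsHermitian) (C : Matrix κ ι 𝕜) : C * critCov hH C = 0 :=
  Matrix.ext_iff_mulVec.mpr fun v => by rw [← mulVec_mulVec, mulVec_critCov_mem_ker, zero_mulVec]

/-- **`C · harmExt = 1`**: the harmonic extension of `B` has average `B`. [folklore] -/
theorem C_mul_harmExt (hH : H.IsHermitian) {C : Matrix κ ι 𝕜} {S : Matrix ι κ 𝕜} (hCS : C * S = 1) :
    C * harmExt hH C S = 1 := by
  rw [harmExt, ← Matrix.mul_assoc, Matrix.mul_sub, Matrix.mul_one, ← Matrix.mul_assoc, mul_critCov_eq_zero, Matrix.zero_mul,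
    sub_zero, hCS]

/-- `C (harmExt B) = B`. [folklore] -/
theorem C_harmExt_mulVec (hH : H.IsHermitian) {C : Matrix κ ι 𝕜} {S : Matrix ι κ 𝕜} (hCS : C * S = 1) (B : κ → 𝕜) :
    C *ᵥ (harmExt hH C S *ᵥ B) = B := by
  rw [mulVec_mulVec, C_mul_harmExt hH hCS, one_mulVec]

/-- The column: `harmExt B = S B + critCov H C (−H S B)`. [folklore] -/
theorem harmExt_mulVec (hH : H.IsHermitian) (C : Matrix κ ι 𝕜) (S : Matrix ι κ 𝕜) (B : κ → 𝕜) :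
    harmExt hH C S *ᵥ B = S *ᵥ B + critCov hH C *ᵥ (-(H *ᵥ (S *ᵥ B))) := by
  rw [harmExt, Matrix.sub_mul, Matrix.one_mul, sub_mulVec, ← mulVec_mulVec, ← mulVec_mulVec, mulVec_neg, sub_eq_add_neg]

/-- The inner variational problem: the correction `critCov H C (−H S B)` is CRITICAL for the source `−H S B` on `ker C` (the source is
automatically invisible to the zero modes of `H`). [folklore] -/
theorem isCrit_inner (hH : H.PosSemidef) (C : Matrix κ ι 𝕜) (S : Matrix ι κ 𝕜) (B : κ → 𝕜) :
    IsCrit H (-(H *ᵥ (S *ᵥ B))) (LinearMap.ker C.mulVecLin) (critCov hH.isHermitian C *ᵥ (-(H *ᵥ (S *ᵥ B)))) :=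
  isCrit_critCov hH C fun z _ hzH => by rw [dotProduct_neg, ker_pairing hH.isHermitian hzH, neg_zero]

/-- **INNER EULER–LAGRANGE**: `H (harmExt B)` is orthogonal to `ker C` — `⟨w, H (harmExt B)⟩ = 0` whenever `C w = 0`. [folklore] -/
theorem harmExt_orth (hH : H.PosSemidef) (C : Matrix κ ι 𝕜) (S : Matrix ι κ 𝕜) (B : κ → 𝕜) {w : ι → 𝕜} (hw : C *ᵥ w = 0) :
    star w ⬝ᵥ (H *ᵥ (harmExt hH.isHermitian C S *ᵥ B)) = 0 := by
  have hcrit := isCrit_inner hH C S B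
  have h := hcrit.2 w ((mem_ker_iff C w).mpr hw)
  have e : H *ᵥ (harmExt hH.isHermitian C S *ᵥ B)
      = -(-(H *ᵥ (S *ᵥ B)) - H *ᵥ (critCov hH.isHermitian C *ᵥ (-(H *ᵥ (S *ᵥ B))))) := by
    rw [harmExt_mulVec, mulVec_add]; abel
  rw [e, dotProduct_neg, h, neg_zero]

/-- The same with the arguments of the pairing exchanged: `⟨H (harmExt B), w⟩ = 0` for `C w = 0`. [folklore] -/
theorem harmExt_orth' (hH : H.PosSemidef) (C : Matrix κ ι 𝕜) (S : Matrix ι κ 𝕜) (B : κ → 𝕜) {w : ι → 𝕜} (hw : C *ᵥ w = 0) :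
    star (H *ᵥ (harmExt hH.isHermitian C S *ᵥ B)) ⬝ᵥ w = 0 := by
  have h := congrArg star (harmExt_orth hH C S B hw)
  rwa [star_dotProduct, star_star, star_zero] at h

/-- **PYTHAGORAS ON THE FIBRE**: for `C w = 0`, `⟨harmExt B + w, H (harmExt B + w)⟩ = ⟨harmExt B, H harmExt B⟩ + ⟨w, H w⟩`. [folklore] -/
theorem quad_harmExt_add (hH : H.PosSemidef) (C : Matrix κ ι 𝕜) (S : Matrix ι κ 𝕜) (B : κ → 𝕜) {w : ι → 𝕜} (hw : C *ᵥ w = 0) :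
    star (harmExt hH.isHermitian C S *ᵥ B + w) ⬝ᵥ (H *ᵥ (harmExt hH.isHermitian C S *ᵥ B + w))
      = star (harmExt hH.isHermitian C S *ᵥ B) ⬝ᵥ (H *ᵥ (harmExt hH.isHermitian C S *ᵥ B)) + star w ⬝ᵥ (H *ᵥ w) := by
  have h1 := harmExt_orth hH C S B hw
  have h2 : star (harmExt hH.isHermitian C S *ᵥ B) ⬝ᵥ (H *ᵥ w) = 0 := by
    have e : star (harmExt hH.isHermitian C S *ᵥ B) ⬝ᵥ (H *ᵥ w) = star (Hᴴ *ᵥ (harmExt hH.isHermitian C S *ᵥ B)) ⬝ᵥ w := by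
      rw [conj_pairing Hᴴ, conjTranspose_conjTranspose]
    rw [e, hH.isHermitian.eq]
    exact harmExt_orth' hH C S B hw
  rw [mulVec_add, star_add, add_dotProduct, dotProduct_add, dotProduct_add, h1, h2, add_zero, zero_add]

/-- **THE HARMONIC EXTENSION MINIMISES THE ENERGY ON THE FIBRE**: `C A = B ⟹ ⟨harmExt B, H harmExt B⟩ ≤ ⟨A, H A⟩`. [folklore] -/
theorem quad_harmExt_le (hH : H.PosSemidef) {C : Matrix κ ι 𝕜} {S : Matrix ι κ 𝕜} (hCS : C * S = 1) {A : ι → 𝕜} {B : κ → 𝕜}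
    (hA : C *ᵥ A = B) :
    star (harmExt hH.isHermitian C S *ᵥ B) ⬝ᵥ (H *ᵥ (harmExt hH.isHermitian C S *ᵥ B)) ≤ star A ⬝ᵥ (H *ᵥ A) := by
  have hw : C *ᵥ (A - harmExt hH.isHermitian C S *ᵥ B) = 0 := by
    rw [mulVec_sub, hA, C_harmExt_mulVec hH.isHermitian hCS, sub_self]
  have e : A = harmExt hH.isHermitian C S *ᵥ B + (A - harmExt hH.isHermitian C S *ᵥ B) := by abel
  rw [e, quad_harmExt_add hH C S B hw]
  exact le_add_of_nonneg_right (hH.dotProduct_mulVec_nonneg _)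

/-- The sesquilinear form of `shortForm`: `⟨y, shortForm B⟩ = ⟨harmExt y, H harmExt B⟩`. [folklore] -/
theorem shortForm_pairing (hH : H.IsHermitian) (C : Matrix κ ι 𝕜) (S : Matrix ι κ 𝕜) (y B : κ → 𝕜) :
    star y ⬝ᵥ (shortForm hH C S *ᵥ B) = star (harmExt hH C S *ᵥ y) ⬝ᵥ (H *ᵥ (harmExt hH C S *ᵥ B)) := by
  rw [shortForm, Matrix.mul_assoc, ← mulVec_mulVec, ← conj_pairing, mulVec_mulVec]

/-- **THE QUADRATIC FORM OF `shortForm` IS THE ENERGY OF THE HARMONIC EXTENSION**: `⟨B, shortForm B⟩ = ⟨harmExt B, H harmExt B⟩`. [folklore] -/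
theorem shortForm_quad (hH : H.IsHermitian) (C : Matrix κ ι 𝕜) (S : Matrix ι κ 𝕜) (B : κ → 𝕜) :
    star B ⬝ᵥ (shortForm hH C S *ᵥ B) = star (harmExt hH C S *ᵥ B) ⬝ᵥ (H *ᵥ (harmExt hH C S *ᵥ B)) :=
  shortForm_pairing hH C S B B

/-- `shortForm` is Hermitian. [folklore] -/
theorem shortForm_isHermitian (hH : H.IsHermitian) (C : Matrix κ ι 𝕜) (S : Matrix ι κ 𝕜) : (shortForm hH C S).IsHermitian :=
  Matrix.isHermitian_conjTranspose_mul_mul _ hH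

/-- `shortForm` is positive semidefinite. [folklore] -/
theorem shortForm_posSemidef (hH : H.PosSemidef) (C : Matrix κ ι 𝕜) (S : Matrix ι κ 𝕜) : (shortForm hH.isHermitian C S).PosSemidef :=
  hH.conjTranspose_mul_mul_same _

/-- **THE MINIMUM PROPERTY**: `C A = B ⟹ ⟨B, shortForm B⟩ ≤ ⟨A, H A⟩`. [folklore] -/
theorem shortForm_quad_le (hH : H.PosSemidef) {C : Matrix κ ι 𝕜} {S : Matrix ι κ 𝕜} (hCS : C * S = 1) {A : ι → 𝕜} {B : κ → 𝕜}
    (hA : C *ᵥ A = B) : star B ⬝ᵥ (shortForm hH.isHermitian C S *ᵥ B) ≤ star A ⬝ᵥ (H *ᵥ A) := by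
  rw [shortForm_quad]
  exact quad_harmExt_le hH hCS hA

/-- **ANY MINIMISER COMPUTES THE SHORTED FORM**: if `A₀` lies in the fibre of `B` and has energy below every other point of the fibre, then
`⟨B, shortForm B⟩ = ⟨A₀, H A₀⟩` (this is how a concrete minimiser — Bałaban's `H_k B` — identifies `shortForm`). [folklore] -/
theorem shortForm_quad_eq_of_isMin (hH : H.PosSemidef) {C : Matrix κ ι 𝕜} {S : Matrix ι κ 𝕜} (hCS : C * S = 1) {A₀ : ι → 𝕜} {B : κ → 𝕜}
    (hA₀ : C *ᵥ A₀ = B) (hmin : ∀ A, C *ᵥ A = B → star A₀ ⬝ᵥ (H *ᵥ A₀) ≤ star A ⬝ᵥ (H *ᵥ A)) :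
    star B ⬝ᵥ (shortForm hH.isHermitian C S *ᵥ B) = star A₀ ⬝ᵥ (H *ᵥ A₀) := by
  refine le_antisymm (shortForm_quad_le hH hCS hA₀) ?_
  rw [shortForm_quad]
  exact hmin _ (C_harmExt_mulVec hH.isHermitian hCS B)

end Shorted

/-! ## §2 The outer Euler–Lagrange identity and the null space of the shorted form -/

section EulerLagrange

variable {H : Matrix ι ι 𝕜}

/-- **OUTER EULER–LAGRANGE: `H · harmExt = Cᴴ · shortForm`** — the energy gradient at the harmonic extension of `B` is the lift of the
shorted-form gradient at `B` (for Bałaban's typed objects: `(½∂ᴴ∂)·H_k = Q*·Δ_k`, tree `Beta.BlockEffectiveAction.curlPart_Hk_mul`). [folklore] -/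
theorem H_mul_harmExt (hH : H.PosSemidef) {C : Matrix κ ι 𝕜} {S : Matrix ι κ 𝕜} (hCS : C * S = 1) :
    H * harmExt hH.isHermitian C S = Cᴴ * shortForm hH.isHermitian C S := by
  refine Matrix.ext_iff_mulVec.mpr fun B => ?_
  rw [← mulVec_mulVec, ← mulVec_mulVec]
  set hE := harmExt hH.isHermitian C S with hEdef
  -- the difference is orthogonal to `ker C` and to `range S`, which together span the fine space
  rw [← sub_eq_zero]
  refine eq_zero_of_forall_pairing fun x => ?_
  have hsplit : x = (x - S *ᵥ (C *ᵥ x)) + S *ᵥ (C *ᵥ x) := by abel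
  have hw : C *ᵥ (x - S *ᵥ (C *ᵥ x)) = 0 := by
    rw [mulVec_sub, mulVec_mulVec, hCS, one_mulVec, sub_self]
  -- on `ker C`
  have h1 : star (x - S *ᵥ (C *ᵥ x)) ⬝ᵥ (H *ᵥ (hE *ᵥ B) - Cᴴ *ᵥ (shortForm hH.isHermitian C S *ᵥ B)) = 0 := by
    rw [dotProduct_sub, hEdef, harmExt_orth hH C S B hw, ← conj_pairing, hw, star_zero, zero_dotProduct, sub_zero]
  -- on `range S`
  have h2 : ∀ y : κ → 𝕜, star (S *ᵥ y) ⬝ᵥ (H *ᵥ (hE *ᵥ B) - Cᴴ *ᵥ (shortForm hH.isHermitian C S *ᵥ B)) = 0 := by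
    intro y
    have hv : C *ᵥ (critCov hH.isHermitian C *ᵥ (-(H *ᵥ (S *ᵥ y)))) = 0 := mulVec_critCov_mem_ker _ _ _
    have e1 : star (S *ᵥ y) ⬝ᵥ (Cᴴ *ᵥ (shortForm hH.isHermitian C S *ᵥ B)) = star y ⬝ᵥ (shortForm hH.isHermitian C S *ᵥ B) := by
      rw [← conj_pairing, mulVec_mulVec, hCS, one_mulVec]
    have e2 : star y ⬝ᵥ (shortForm hH.isHermitian C S *ᵥ B) = star (S *ᵥ y) ⬝ᵥ (H *ᵥ (hE *ᵥ B)) := by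
      rw [shortForm_pairing, ← hEdef, hEdef, harmExt_mulVec, ← hEdef, star_add, add_dotProduct, harmExt_orth hH C S B hv, add_zero]
    rw [dotProduct_sub, e1, e2, sub_self]
  rw [hsplit, star_add, add_dotProduct, h1, h2, add_zero]

/-- Columnwise: `H (harmExt B) = Cᴴ (shortForm B)`. [folklore] -/
theorem H_harmExt_mulVec (hH : H.PosSemidef) {C : Matrix κ ι 𝕜} {S : Matrix ι κ 𝕜} (hCS : C * S = 1) (B : κ → 𝕜) :
    H *ᵥ (harmExt hH.isHermitian C S *ᵥ B) = Cᴴ *ᵥ (shortForm hH.isHermitian C S *ᵥ B) := by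
  rw [mulVec_mulVec, mulVec_mulVec, H_mul_harmExt hH hCS]

/-- **NULL VECTORS OF THE SHORTED FORM LIFT TO NULL VECTORS OF `H`**: `shortForm z = 0 ⟹ H (harmExt z) = 0` (and `C (harmExt z) = z`). [folklore] -/
theorem harmExt_ker_of_shortForm_ker (hH : H.PosSemidef) (C : Matrix κ ι 𝕜) (S : Matrix ι κ 𝕜) {z : κ → 𝕜}
    (hz : shortForm hH.isHermitian C S *ᵥ z = 0) : H *ᵥ (harmExt hH.isHermitian C S *ᵥ z) = 0 := by
  have h : star z ⬝ᵥ (shortForm hH.isHermitian C S *ᵥ z) = 0 := by rw [hz, dotProduct_zero]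
  rw [shortForm_quad] at h
  exact (hH.dotProduct_mulVec_zero_iff _).mp h

/-- **CONVERSELY**: if `z = C A` for a null vector `A` of `H`, then `shortForm z = 0` — the null space of the shorted form is exactly `C (ker H)`. [folklore] -/
theorem shortForm_mulVec_eq_zero_of_lift (hH : H.PosSemidef) {C : Matrix κ ι 𝕜} {S : Matrix ι κ 𝕜} (hCS : C * S = 1) {A : ι → 𝕜}
    {z : κ → 𝕜} (hA : C *ᵥ A = z) (hHA : H *ᵥ A = 0) : shortForm hH.isHermitian C S *ᵥ z = 0 := by
  have h1 : star z ⬝ᵥ (shortForm hH.isHermitian C S *ᵥ z) ≤ 0 := by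
    have h := shortForm_quad_le hH hCS hA
    rwa [hHA, dotProduct_zero] at h
  have h2 : 0 ≤ star z ⬝ᵥ (shortForm hH.isHermitian C S *ᵥ z) := (shortForm_posSemidef hH C S).dotProduct_mulVec_nonneg z
  exact ((shortForm_posSemidef hH C S).dotProduct_mulVec_zero_iff z).mp (le_antisymm h1 h2)

/-- **THE SHORTED FORM DOES NOT DEPEND ON THE SECTION.** [folklore] -/
theorem shortForm_eq_of_sections (hH : H.PosSemidef) {C : Matrix κ ι 𝕜} {S S' : Matrix ι κ 𝕜} (hCS : C * S = 1) (hCS' : C * S' = 1) :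
    shortForm hH.isHermitian C S = shortForm hH.isHermitian C S' := by
  refine hermitian_ext_of_quad (shortForm_isHermitian hH.isHermitian C S) (shortForm_isHermitian hH.isHermitian C S') fun B => ?_
  refine le_antisymm ?_ ?_
  · rw [shortForm_quad hH.isHermitian C S']
    exact shortForm_quad_le hH hCS (C_harmExt_mulVec hH.isHermitian hCS' B)
  · rw [shortForm_quad hH.isHermitian C S]
    exact shortForm_quad_le hH hCS' (C_harmExt_mulVec hH.isHermitian hCS B)

end EulerLagrange

/-! ## §3 The two-stage variational identity -/

section TwoStage

variable {H : Matrix ι ι 𝕜} {ρ : Type*} [Fintype ρ] [DecidableEq ρ]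

omit [Fintype ρ] [DecidableEq ρ] in
/-- **LEGITIMACY LIFTS.**  If the coarse source `r` is invisible to the coarse constrained zero modes (`R z = 0 ∧ shortForm z = 0 ⟹ ⟨z, r⟩ = 0`),
then the fine source `Cᴴ r` is invisible to the fine constrained zero modes (`R C Z = 0 ∧ H Z = 0 ⟹ ⟨Z, Cᴴ r⟩ = 0`). [folklore] -/
theorem legit_lift (hH : H.PosSemidef) {C : Matrix κ ι 𝕜} {S : Matrix ι κ 𝕜} (hCS : C * S = 1) (R : Matrix ρ κ 𝕜) {r : κ → 𝕜}
    (hr : ∀ z, R *ᵥ z = 0 → shortForm hH.isHermitian C S *ᵥ z = 0 → star z ⬝ᵥ r = 0) :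
    ∀ Z, (R * C) *ᵥ Z = 0 → H *ᵥ Z = 0 → star Z ⬝ᵥ (Cᴴ *ᵥ r) = 0 := by
  intro Z hRZ hHZ
  rw [← conj_pairing]
  refine hr (C *ᵥ Z) (by rwa [mulVec_mulVec]) (shortForm_mulVec_eq_zero_of_lift hH hCS rfl hHZ)

omit [DecidableEq ι] in
/-- **CROSS PAIRINGS OF CRITICAL POINTS**: `p` critical for the source `s` and `p'` critical for `s'` on the same subspace ⟹ `⟨s, p'⟩ = ⟨p, s'⟩`
(hence the cross pairing `⟨s, p'⟩` does not depend on WHICH critical point `p'` is used). [folklore] -/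
theorem cross_pairing_eq_of_isCrit (hH : H.IsHermitian) {s s' p p' : ι → 𝕜} {K : Submodule 𝕜 (ι → 𝕜)} (hp : IsCrit H s K p)
    (hp' : IsCrit H s' K p') : star s ⬝ᵥ p' = star p ⬝ᵥ s' := by
  have h1 : star (s - H *ᵥ p) ⬝ᵥ p' = 0 := by
    have h := congrArg star (hp.2 p' hp'.1)
    rwa [star_dotProduct, star_star, star_zero] at h
  have h2 : star p ⬝ᵥ (s' - H *ᵥ p') = 0 := hp'.2 p hp.1
  have e1 : star s ⬝ᵥ p' = star (s - H *ᵥ p) ⬝ᵥ p' + star (H *ᵥ p) ⬝ᵥ p' := by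
    rw [star_sub, sub_dotProduct]; abel
  have e2 : star p ⬝ᵥ s' = star p ⬝ᵥ (s' - H *ᵥ p') + star p ⬝ᵥ (H *ᵥ p') := by
    rw [dotProduct_sub]; abel
  rw [e1, e2, h1, h2, zero_add, zero_add, conj_pairing, hH.eq]

omit [Fintype ρ] [DecidableEq ρ] in
/-- **THE HARMONIC EXTENSION OF A COARSE CRITICAL POINT IS A FINE CRITICAL POINT**: `v` critical for `(shortForm, r)` on `ker R` ⟹ `harmExt v`
critical for `(H, Cᴴ r)` on `ker (R C)`. [folklore] -/
theorem isCrit_harmExt (hH : H.PosSemidef) {C : Matrix κ ι 𝕜} {S : Matrix ι κ 𝕜} (hCS : C * S = 1) (R : Matrix ρ κ 𝕜) {r v : κ → 𝕜}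
    (hv : IsCrit (shortForm hH.isHermitian C S) r (LinearMap.ker R.mulVecLin) v) :
    IsCrit H (Cᴴ *ᵥ r) (LinearMap.ker (R * C).mulVecLin) (harmExt hH.isHermitian C S *ᵥ v) := by
  have hvR : R *ᵥ v = 0 := (mem_ker_iff R v).mp hv.1
  refine ⟨(mem_ker_iff (R * C) _).mpr ?_, fun W hW => ?_⟩
  · rw [← mulVec_mulVec, C_harmExt_mulVec hH.isHermitian hCS, hvR]
  · have hW' : R *ᵥ (C *ᵥ W) = 0 := by rw [mulVec_mulVec]; exact (mem_ker_iff (R * C) W).mp hW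
    rw [H_harmExt_mulVec hH hCS, ← mulVec_sub, ← conj_pairing]
    exact hv.2 (C *ᵥ W) ((mem_ker_iff R _).mpr hW')

/-- **THE TWO-STAGE IDENTITY FOR PAIRINGS**: for coarse sources `r, r'` invisible to `ker R ∩ ker shortForm`,
`⟨Cᴴ r, critCov H (R C) (Cᴴ r')⟩ = ⟨r, critCov (shortForm H C) R r'⟩` — constraining the fine field through its averages and reading through
`C` is the same as constraining the averages under the shorted form. [folklore] -/
theorem pairing_twoStage (hH : H.PosSemidef) {C : Matrix κ ι 𝕜} {S : Matrix ι κ 𝕜} (hCS : C * S = 1) (R : Matrix ρ κ 𝕜) {r r' : κ → 𝕜}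
    (hr : ∀ z, R *ᵥ z = 0 → shortForm hH.isHermitian C S *ᵥ z = 0 → star z ⬝ᵥ r = 0)
    (hr' : ∀ z, R *ᵥ z = 0 → shortForm hH.isHermitian C S *ᵥ z = 0 → star z ⬝ᵥ r' = 0) :
    star (Cᴴ *ᵥ r) ⬝ᵥ (critCov hH.isHermitian (R * C) *ᵥ (Cᴴ *ᵥ r'))
      = star r ⬝ᵥ (critCov (shortForm_isHermitian hH.isHermitian C S) R *ᵥ r') := by
  have hE := shortForm_posSemidef hH C S
  -- coarse critical point for `r'` and its harmonic extension (fine critical for `Cᴴ r'`)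
  have hv' := isCrit_critCov hE R (r := r') fun z hzR hzE => hr' z hzR hzE
  have hA' := isCrit_harmExt hH hCS R hv'
  -- fine canonical critical points for `Cᴴ r` and `Cᴴ r'`
  have hu := isCrit_critCov hH (R * C) (r := Cᴴ *ᵥ r) (legit_lift hH hCS R hr)
  have hu' := isCrit_critCov hH (R * C) (r := Cᴴ *ᵥ r') (legit_lift hH hCS R hr')
  calc star (Cᴴ *ᵥ r) ⬝ᵥ (critCov hH.isHermitian (R * C) *ᵥ (Cᴴ *ᵥ r'))
      = star (critCov hH.isHermitian (R * C) *ᵥ (Cᴴ *ᵥ r)) ⬝ᵥ (Cᴴ *ᵥ r') := cross_pairing_eq_of_isCrit hH.isHermitian hu hu'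
    _ = star (Cᴴ *ᵥ r) ⬝ᵥ (harmExt hH.isHermitian C S *ᵥ (critCov hE.isHermitian R *ᵥ r')) :=
        (cross_pairing_eq_of_isCrit hH.isHermitian hu hA').symm
    _ = star r ⬝ᵥ (C *ᵥ (harmExt hH.isHermitian C S *ᵥ (critCov hE.isHermitian R *ᵥ r'))) := by
        rw [conj_pairing, conjTranspose_conjTranspose]
    _ = star r ⬝ᵥ (critCov (shortForm_isHermitian hH.isHermitian C S) R *ᵥ r') := by
        rw [C_harmExt_mulVec hH.isHermitian hCS]

omit [DecidableEq κ] in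
/-- The quadratic form of a read-out matrix `X Γ Xᴴ` at `u` is the pairing of the read source `Xᴴ u`. [folklore] -/
theorem readOut_quad {τ : Type*} [Fintype τ] (X : Matrix τ κ 𝕜) (Γ : Matrix κ κ 𝕜) (u : τ → 𝕜) :
    star u ⬝ᵥ ((X * Γ * Xᴴ) *ᵥ u) = star (Xᴴ *ᵥ u) ⬝ᵥ (Γ *ᵥ (Xᴴ *ᵥ u)) := by
  rw [← mulVec_mulVec, ← mulVec_mulVec, ← conjTranspose_conjTranspose X, ← conj_pairing, conjTranspose_conjTranspose]

/-- **THE TWO-STAGE IDENTITY FOR READ-OUT MATRICES.**  For every test matrix `T` on the coarse space KILLING the coarse constrained zero modes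
(`R z = 0 ∧ shortForm z = 0 ⟹ T z = 0`): `(T C)·critCov H (R C)·(T C)ᴴ = T·critCov (shortForm H C) R·Tᴴ`. [folklore] -/
theorem readOut_twoStage {τ : Type*} [Fintype τ] [DecidableEq τ] (hH : H.PosSemidef) {C : Matrix κ ι 𝕜} {S : Matrix ι κ 𝕜}
    (hCS : C * S = 1) (R : Matrix ρ κ 𝕜) (T : Matrix τ κ 𝕜)
    (hT : ∀ z, R *ᵥ z = 0 → shortForm hH.isHermitian C S *ᵥ z = 0 → T *ᵥ z = 0) :
    (T * C) * critCov hH.isHermitian (R * C) * (T * C)ᴴ = T * critCov (shortForm_isHermitian hH.isHermitian C S) R * Tᴴ := by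
  have hlegit : ∀ u : τ → 𝕜, ∀ z, R *ᵥ z = 0 → shortForm hH.isHermitian C S *ᵥ z = 0 → star z ⬝ᵥ (Tᴴ *ᵥ u) = 0 := by
    intro u z hzR hzE
    rw [← conj_pairing, hT z hzR hzE, star_zero, zero_dotProduct]
  have h1 : ((T * C) * critCov hH.isHermitian (R * C) * (T * C)ᴴ).IsHermitian :=
    Matrix.isHermitian_mul_mul_conjTranspose _ (critCov_isHermitian hH.isHermitian _)
  have h2 : (T * critCov (shortForm_isHermitian hH.isHermitian C S) R * Tᴴ).IsHermitian :=
    Matrix.isHermitian_mul_mul_conjTranspose _ (critCov_isHermitian _ _)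
  refine hermitian_ext_of_quad h1 h2 fun u => ?_
  rw [readOut_quad, readOut_quad, conjTranspose_mul, ← mulVec_mulVec]
  exact pairing_twoStage hH hCS R (hlegit u) (hlegit u)

end TwoStage

/-! ## §4 The degenerate (OSD): shorted forms increase under refinement -/

section OSD

variable {ι₀ ι₁ : Type*} [Fintype ι₀] [DecidableEq ι₀] [Fintype ι₁] [DecidableEq ι₁]
variable {Hc : Matrix ι₀ ι₀ 𝕜} {Hf : Matrix ι₁ ι₁ 𝕜}

/-- **(STAB) + (1.17) ⟹ THE SHORTED FORMS INCREASE UNDER REFINEMENT.**  Coarse∕fine PSD forms `H_c, H_f` (degenerate allowed), one refinement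
step `Cf : ι₁ → ι₀` with (STAB) `(H_f − Cfᴴ H_c Cf).PosSemidef` («one averaging step does not increase the energy»), readings `C_c` of the coarse
level and `C_f = C_c · Cf` of the fine level ((1.17)), with sections.  Then `shortForm H_c C_c ≤ shortForm H_f C_f` in the Loewner order:
`E_c(B) = min_{C_c A = B} ⟨A, H_c A⟩ ≤ ⟨Cf A′, H_c Cf A′⟩ ≤ ⟨A′, H_f A′⟩` for every `A′` in the fine fibre of `B`. [folklore] -/
theorem shortForm_coarsen_le (hHc : Hc.PosSemidef) (hHf : Hf.PosSemidef) {Cf : Matrix ι₀ ι₁ 𝕜} (hstab : (Hf - Cfᴴ * Hc * Cf).PosSemidef)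
    {Cc : Matrix κ ι₀ 𝕜} {Sc : Matrix ι₀ κ 𝕜} (hSc : Cc * Sc = 1) {Sf : Matrix ι₁ κ 𝕜} (hSf : (Cc * Cf) * Sf = 1) :
    (shortForm hHf.isHermitian (Cc * Cf) Sf - shortForm hHc.isHermitian Cc Sc).PosSemidef := by
  refine PosSemidef.of_dotProduct_mulVec_nonneg
    ((shortForm_isHermitian hHf.isHermitian _ _).sub (shortForm_isHermitian hHc.isHermitian _ _)) fun B => ?_
  rw [sub_mulVec, dotProduct_sub, sub_nonneg]
  set A' := harmExt hHf.isHermitian (Cc * Cf) Sf *ᵥ B with hA'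
  have hfib : Cc *ᵥ (Cf *ᵥ A') = B := by rw [mulVec_mulVec, hA', C_harmExt_mulVec hHf.isHermitian hSf]
  clear_value A'
  have h0 := hstab.dotProduct_mulVec_nonneg A'
  rw [sub_mulVec, dotProduct_sub, sub_nonneg] at h0
  have e3 : star A' ⬝ᵥ ((Cfᴴ * Hc * Cf) *ᵥ A') = star (Cf *ᵥ A') ⬝ᵥ (Hc *ᵥ (Cf *ᵥ A')) := by
    rw [← mulVec_mulVec, ← mulVec_mulVec, ← conj_pairing]
  calc star B ⬝ᵥ (shortForm hHc.isHermitian Cc Sc *ᵥ B)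
      ≤ star (Cf *ᵥ A') ⬝ᵥ (Hc *ᵥ (Cf *ᵥ A')) := shortForm_quad_le hHc hSc hfib
    _ ≤ star A' ⬝ᵥ (Hf *ᵥ A') := by rw [← e3]; exact h0
    _ = star B ⬝ᵥ (shortForm hHf.isHermitian (Cc * Cf) Sf *ᵥ B) := by rw [shortForm_quad, hA']

end OSD

end Summit.QuantumFields.BalabanUV.Beta.GAN24.MonotoneShorted
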